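import Mathlib
import Literature.NumberTheory.LFunctions.Zhang2022.Section17InnerChiIdentities
import Literature.NumberTheory.LFunctions.Zhang2022.TypedSection17RelE
import HarnessLib

/-!
# Zhang (2022) §17.u021 in the χ-twisted reading: the DROPPING DECOMPOSITION — the sum of (17.8) is
# EXACTLY the kept main sum plus the two dropped remainders — and the edge reducing the typed node
# `Typed.Section17.Step17_u021Chi` to two remainder bounds

Topic `Literature/NumberTheory/LFunctions/Zhang2022` (Landau–Siegel audit tree; verdict-neutral).
Y. Zhang, *Discrete mean estimates and the Landau–Siegel zero*, arXiv:2211.02515v1 (2022)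
[Zhang2022LandauSiegel] — **an unrefereed manuscript under adjudication; nothing in this file asserts or
denies its Theorems 1–2, and no claim about Landau–Siegel zeros is made.** ZHANG-L discharge lane, WP16
helper under the leaf `Typed.Section17.Eq17_9Rel` (owner of the chain: zl-w16-p3; WP16-PLAN §1.6; node of
record `Typed.Section17.Step17_u021Chi`, the χ-twisted reading RT16-int-1 of `Z22:§17.u021`).

§17 p. 98 (tex L4823–L4827), after the re-indexing u020:

> On the right side above, we can drop the terms with `m₂ > 1` or `(m₁,𝔮) > 1` with an acceptable error.
> Hence `Σ_n (b∗ν₁*)(n)ϱ*(n)/n = Σ_{l<D⁴}(ν(l)/l)Σ_{l=l₁l₂}Σ_{(m₁,𝔮)=1} b(l₁m₁)ν₁*(l₂)κ̄₂(m₁)/m₁ + o(1)`.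

The manuscript gives no bound for the dropped terms. This file does the EXACT BOOKKEEPING of the
sentence, once for arbitrary finitely supported coefficients and then at the χ-twisted coefficient
`(bχ)∗ν₁*` of record: with `T(q,m₁,m₂) = b(q₁m₁)χ(q₁m₁)ν₁*(q₂m₂)κ̄₂(m₁m₂)/(m₁m₂)`,

  `Σ_n ((bχ)∗ν₁*)(n)ϱ*(n)/n = MAIN + R₂ + R₁`,

where `MAIN` is the kept sum of `Step17_u021Chi` VERBATIM (`m₂ = 1`, `(m₁,𝔮) = 1`), `R₂` collects the
terms `m₂ = 1`, `(m₁,𝔮) > 1`, and `R₁` the terms `m₂ ≥ 2` (with the side condition `(m₂,l₁) = 1` of u020)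
(`tsum_conv_varrho17_chi_decomposition`; inputs: the landed identities `step17_u019_chi`, `step17_u020_chi`
of `Section17InnerChiIdentities`). Consequently (`step17_u021Chi_of_remainders`) the node
`Step17_u021Chi c′` FOLLOWS from the two remainder estimates `R₁ = o(1)`, `R₂ = o(1)` (spelled inline, in the
node's own `∀ ε > 0, ForAllLarge, (A) →` currency) — which are the actual content of "with an acceptable
error" and remain with the chain's owner (majorants: `MeanSquareMajorant.norm_kappa₂_prime_le`,
`AppendixAKappa2PrimePowers`, zl-w16-p3's `Section17NuOneStarMajorant`). Theorems only; no definition, no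
claim node; standard axioms.

## References

* Y. Zhang, arXiv:2211.02515v1 (2022), §17 p. 98 (u020–u021), tex L4821–L4827.
  [cite: Zhang2022LandauSiegel, §17 u021 p.98]
-/

noncomputable section

open Complex Real ComplexConjugate Finset
open scoped LSeries.notation

namespace Literature.NumberTheory.LFunctions.Zhang2022.Typed.Section17

open Literature.NumberTheory.LFunctions.Zhang2022
open Literature.NumberTheory.LFunctions.Zhang2022.Skeleton

/-! ## Generic three-way split of the re-indexed inner sum -/

section Generic

/-- **The dropping decomposition of §17.u021, generic.** For `f, g` vanishing from `N` on, any `v`, a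
factorisation `q = (q₁,q₂)` with `q₁, q₂ ≥ 1` and any modulus `Q`, the re-indexed inner sum of u020 splits
EXACTLY as (kept: `m₂ = 1`, `(m₁,Q) = 1`) + (dropped: `m₂ = 1`, `(m₁,Q) > 1`) + (dropped: `m₂ ≥ 2`):
`Σ_{m₁}Σ_{(m₂,q₁)=1} f(q₁m₁)g(q₂m₂)v(m₁m₂)/(m₁m₂) = Σ_{(m₁,Q)=1} f(q₁m₁)g(q₂)v(m₁)/m₁
+ Σ_{(m₁,Q)>1} f(q₁m₁)g(q₂)v(m₁)/m₁ + Σ_{m₁}Σ_{m₂≥2,(m₂,q₁)=1} f(q₁m₁)g(q₂m₂)v(m₁m₂)/(m₁m₂)`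
(all sums finite). [cite: Zhang2022LandauSiegel, §17 u021 p.98] -/
theorem tsum_tsum_coprime_split {f g v : ℕ → ℂ} {N : ℕ} (hf : ∀ n, N ≤ n → f n = 0)
    (hg : ∀ n, N ≤ n → g n = 0) (q : ℕ × ℕ) (hq1 : 1 ≤ q.1) (hq2 : 1 ≤ q.2) (Q : ℕ) :
    (∑' m₁ : ℕ, ∑' m₂ : ℕ,
        if Nat.Coprime m₂ q.1 then f (q.1 * m₁) * g (q.2 * m₂) * v (m₁ * m₂) / ((m₁ : ℂ) * m₂)
        else 0) =
      (∑' m₁ : ℕ, if Nat.Coprime m₁ Q then f (q.1 * m₁) * g q.2 * v m₁ / (m₁ : ℂ) else 0) +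
      (∑' m₁ : ℕ, if ¬ Nat.Coprime m₁ Q then f (q.1 * m₁) * g q.2 * v m₁ / (m₁ : ℂ) else 0) +
      ∑' m₁ : ℕ, ∑' m₂ : ℕ,
        if 2 ≤ m₂ ∧ Nat.Coprime m₂ q.1 then
          f (q.1 * m₁) * g (q.2 * m₂) * v (m₁ * m₂) / ((m₁ : ℂ) * m₂)
        else 0 := by
  classical
  -- notation-free abbreviations
  set T : ℕ → ℕ → ℂ := fun m₁ m₂ => f (q.1 * m₁) * g (q.2 * m₂) * v (m₁ * m₂) / ((m₁ : ℂ) * m₂)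
    with hT
  set T₁ : ℕ → ℂ := fun m₁ => f (q.1 * m₁) * g q.2 * v m₁ / (m₁ : ℂ) with hT₁
  -- support facts
  have hf' : ∀ m₁, N ≤ m₁ → ∀ m₂, T m₁ m₂ = 0 := by
    intro m₁ hm₁ m₂
    simp only [hT]
    rw [hf _ (le_trans hm₁ (Nat.le_mul_of_pos_left m₁ hq1)), zero_mul, zero_mul, zero_div]
  have hg' : ∀ m₂, N ≤ m₂ → ∀ m₁, T m₁ m₂ = 0 := by
    intro m₂ hm₂ m₁
    simp only [hT]
    rw [hg _ (le_trans hm₂ (Nat.le_mul_of_pos_left m₂ hq2)), mul_zero, zero_mul, zero_div]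
  have hT₁_eq : ∀ m₁, T m₁ 1 = T₁ m₁ := by
    intro m₁; simp only [hT, hT₁, mul_one, Nat.cast_one]
  have hT₁' : ∀ m₁, N ≤ m₁ → T₁ m₁ = 0 := by
    intro m₁ hm₁; rw [← hT₁_eq]; exact hf' m₁ hm₁ 1
  have hT0 : ∀ m₁, T m₁ 0 = 0 := by intro m₁; simp [hT]
  -- summability of finitely supported families (in `m₂` for fixed `m₁`, and in `m₁`)
  have summ₂ : ∀ (P : ℕ → Prop) [DecidablePred P] (m₁ : ℕ),
      Summable fun m₂ => if P m₂ then T m₁ m₂ else 0 := by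
    intro P _ m₁
    refine summable_of_ne_finset_zero (s := Finset.range N) fun m₂ hm₂ => ?_
    have : N ≤ m₂ := by simpa using hm₂
    simp [hg' m₂ this m₁]
  have summ₁ : ∀ (F : ℕ → ℂ), (∀ m₁, N ≤ m₁ → F m₁ = 0) → Summable F := by
    intro F hF
    exact summable_of_ne_finset_zero (s := Finset.range N) fun m₁ hm₁ => hF m₁ (by simpa using hm₁)
  -- (A) the `m₂`-split for fixed `m₁`: coprime sum = (m₂ = 1 term) + (m₂ ≥ 2 terms)
  have splitA : ∀ m₁ : ℕ,
      (∑' m₂ : ℕ, if Nat.Coprime m₂ q.1 then T m₁ m₂ else 0) =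
        T₁ m₁ + ∑' m₂ : ℕ, if 2 ≤ m₂ ∧ Nat.Coprime m₂ q.1 then T m₁ m₂ else 0 := by
    intro m₁
    have hpt : ∀ m₂ : ℕ, (if Nat.Coprime m₂ q.1 then T m₁ m₂ else 0) =
        (if m₂ = 1 then T₁ m₁ else 0) + (if 2 ≤ m₂ ∧ Nat.Coprime m₂ q.1 then T m₁ m₂ else 0) := by
      intro m₂
      rcases Nat.lt_or_ge m₂ 2 with h | h
      · interval_cases m₂
        · simp [hT0 m₁]
        · simp [hT₁_eq]
      · have hne : m₂ ≠ 1 := by omega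
        simp [h, hne]
    rw [tsum_congr hpt, Summable.tsum_add _ (summ₂ _ m₁), tsum_ite_eq]
    exact ⟨_, hasSum_ite_eq 1 (T₁ m₁)⟩
  -- (B) the `m₁`-split of the `m₂ = 1` terms by coprimality with `Q`
  have splitB : (∑' m₁ : ℕ, T₁ m₁) =
      (∑' m₁ : ℕ, if Nat.Coprime m₁ Q then T₁ m₁ else 0) +
        ∑' m₁ : ℕ, if ¬ Nat.Coprime m₁ Q then T₁ m₁ else 0 := by
    have hpt : ∀ m₁ : ℕ, T₁ m₁ =
        (if Nat.Coprime m₁ Q then T₁ m₁ else 0) + (if ¬ Nat.Coprime m₁ Q then T₁ m₁ else 0) := by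
      intro m₁; split_ifs <;> simp
    rw [tsum_congr hpt]
    exact Summable.tsum_add (summ₁ _ fun m₁ h => by simp [hT₁' m₁ h])
      (summ₁ _ fun m₁ h => by simp [hT₁' m₁ h])
  -- assemble
  have hs1 : Summable fun m₁ => T₁ m₁ := summ₁ _ hT₁'
  have hs2 : Summable fun m₁ => ∑' m₂ : ℕ, if 2 ≤ m₂ ∧ Nat.Coprime m₂ q.1 then T m₁ m₂ else 0 :=
    summ₁ _ fun m₁ h => by
      rw [tsum_congr (fun m₂ => by rw [hf' m₁ h m₂, ite_self]), tsum_zero]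
  show (∑' m₁ : ℕ, ∑' m₂ : ℕ, if Nat.Coprime m₂ q.1 then T m₁ m₂ else 0) =
      (∑' m₁ : ℕ, if Nat.Coprime m₁ Q then T₁ m₁ else 0) +
      (∑' m₁ : ℕ, if ¬ Nat.Coprime m₁ Q then T₁ m₁ else 0) +
      ∑' m₁ : ℕ, ∑' m₂ : ℕ, if 2 ≤ m₂ ∧ Nat.Coprime m₂ q.1 then T m₁ m₂ else 0
  rw [tsum_congr splitA, Summable.tsum_add hs1 hs2, splitB]

end Generic

/-! ## The decomposition at the χ-twisted coefficient and the edge to `Step17_u021Chi` -/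

section Chi

variable (c' : ℝ) {D : ℕ} (χ : DirichletCharacter ℂ D)

/-- **§17.u021-χ, EXACT BOOKKEEPING.** For every modulus `D` and every `c′`:
`Σ_n ((bχ)∗ν₁*)(n)ϱ*(n)/n = MAIN + R₂ + R₁`, where `MAIN` is the kept sum of
`Typed.Section17.Step17_u021Chi` verbatim (`m₂ = 1`, `(m₁,𝔮) = 1`), `R₂` the dropped terms with
`(m₁,𝔮) > 1` (`m₂ = 1`) and `R₁` the dropped terms with `m₂ ≥ 2` (u019-χ, u020-χ and the generic
three-way split). "We can drop the terms with `m₂ > 1` or `(m₁,𝔮) > 1`" (§17 p. 98) is thus EXACTLY the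
claim `R₁ + R₂ = o(1)`. [cite: Zhang2022LandauSiegel, §17 u021 p.98] -/
theorem tsum_conv_varrho17_chi_decomposition :
    (∑' n : ℕ, LSeries.convolution (fun n => bcoef D n * χ (n : ZMod D)) (nuOneStar c' χ) n *
        varrho17 c' χ n / (n : ℂ)) =
      (∑ l ∈ Finset.Ico 1 (D ^ 4), nu χ l / (l : ℂ) *
          ∑ q ∈ l.divisorsAntidiagonal, ∑' m₁ : ℕ,
            if Nat.Coprime m₁ (frakq D) then
              bcoef D (q.1 * m₁) * χ ((q.1 * m₁ : ℕ) : ZMod D) * nuOneStar c' χ q.2 *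
                kappa2bar c' D m₁ / (m₁ : ℂ)
            else 0) +
      (∑ l ∈ Finset.Ico 1 (D ^ 4), nu χ l / (l : ℂ) *
          ∑ q ∈ l.divisorsAntidiagonal, ∑' m₁ : ℕ,
            if ¬ Nat.Coprime m₁ (frakq D) then
              bcoef D (q.1 * m₁) * χ ((q.1 * m₁ : ℕ) : ZMod D) * nuOneStar c' χ q.2 *
                kappa2bar c' D m₁ / (m₁ : ℂ)
            else 0) +
      ∑ l ∈ Finset.Ico 1 (D ^ 4), nu χ l / (l : ℂ) *
          ∑ q ∈ l.divisorsAntidiagonal, ∑' m₁ : ℕ, ∑' m₂ : ℕ,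
            if 2 ≤ m₂ ∧ Nat.Coprime m₂ q.1 then
              bcoef D (q.1 * m₁) * χ ((q.1 * m₁ : ℕ) : ZMod D) * nuOneStar c' χ (q.2 * m₂) *
                kappa2bar c' D (m₁ * m₂) / ((m₁ : ℂ) * m₂)
            else 0 := by
  classical
  obtain ⟨hb, hν⟩ := bcoefChi_nuOneStar_support c' χ
  rw [step17_u019_chi c' χ, ← Finset.sum_add_distrib, ← Finset.sum_add_distrib]
  refine Finset.sum_congr rfl fun l hl => ?_
  have hl1 : 1 ≤ l := (Finset.mem_Ico.mp hl).1
  rw [step17_u020_chi c' χ l hl1, ← mul_add, ← mul_add, ← Finset.sum_add_distrib,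
    ← Finset.sum_add_distrib]
  congr 1
  refine Finset.sum_congr rfl fun q hq => ?_
  have hq0 := Nat.mem_divisorsAntidiagonal.mp hq
  have hq1 : 1 ≤ q.1 := Nat.one_le_iff_ne_zero.mpr fun h => hq0.2 (by rw [← hq0.1, h, zero_mul])
  have hq2 : 1 ≤ q.2 := Nat.one_le_iff_ne_zero.mpr fun h => hq0.2 (by rw [← hq0.1, h, mul_zero])
  exact tsum_tsum_coprime_split (f := fun n => bcoef D n * χ (n : ZMod D)) (g := nuOneStar c' χ)
    (v := kappa2bar c' D) hb hν q hq1 hq2 (frakq D)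

/-- **`Z22:§17.u021` (χ-twisted reading, node `Typed.Section17.Step17_u021Chi`) FOLLOWS FROM THE TWO
REMAINDER ESTIMATES** — "we can drop the terms with `m₂ > 1` [R₁] or `(m₁,𝔮) > 1` [R₂] with an acceptable
error" (§17 p. 98): if `R₁ = o(1)` and `R₂ = o(1)` (each in the node's own `∀ ε>0, ForAllLarge, (A) →`
currency), then `Step17_u021Chi c′`. Pure consequence of the exact decomposition; the two estimates are
the content left to prove. [cite: Zhang2022LandauSiegel, §17 u021 p.98] -/
theorem step17_u021Chi_of_remainders
    (hR₁ : ∀ ε : ℝ, 0 < ε → ForAllLarge fun D _ χ => AssumptionA D χ →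
      ‖∑ l ∈ Finset.Ico 1 (D ^ 4), nu χ l / (l : ℂ) *
          ∑ q ∈ l.divisorsAntidiagonal, ∑' m₁ : ℕ, ∑' m₂ : ℕ,
            if 2 ≤ m₂ ∧ Nat.Coprime m₂ q.1 then
              bcoef D (q.1 * m₁) * χ ((q.1 * m₁ : ℕ) : ZMod D) * nuOneStar c' χ (q.2 * m₂) *
                kappa2bar c' D (m₁ * m₂) / ((m₁ : ℂ) * m₂)
            else 0‖ ≤ ε)
    (hR₂ : ∀ ε : ℝ, 0 < ε → ForAllLarge fun D _ χ => AssumptionA D χ →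
      ‖∑ l ∈ Finset.Ico 1 (D ^ 4), nu χ l / (l : ℂ) *
          ∑ q ∈ l.divisorsAntidiagonal, ∑' m₁ : ℕ,
            if ¬ Nat.Coprime m₁ (frakq D) then
              bcoef D (q.1 * m₁) * χ ((q.1 * m₁ : ℕ) : ZMod D) * nuOneStar c' χ q.2 *
                kappa2bar c' D m₁ / (m₁ : ℂ)
            else 0‖ ≤ ε) :
    Step17_u021Chi c' := by
  intro ε hε
  obtain ⟨D₁, h₁⟩ := hR₁ (ε / 2) (by linarith)
  obtain ⟨D₂, h₂⟩ := hR₂ (ε / 2) (by linarith)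
  refine ⟨max D₁ D₂, fun D _ χ hD hq hp hA => ?_⟩
  have e₁ := h₁ D χ (le_trans (le_max_left _ _) hD) hq hp hA
  have e₂ := h₂ D χ (le_trans (le_max_right _ _) hD) hq hp hA
  rw [tsum_conv_varrho17_chi_decomposition c' χ, add_assoc, add_sub_cancel_left]
  calc _ ≤ _ := norm_add_le _ _
    _ ≤ ε / 2 + ε / 2 := add_le_add e₂ e₁
    _ = ε := by ring

end Chi

end Literature.NumberTheory.LFunctions.Zhang2022.Typed.Section17

end
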